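import Literature.AnabelianGeometry.EtaleTheta.TemperedFrobenioidToyCone
import HarnessLib

/-!
# The swap `(m, (u,n), (v,w)) ↦ (m, (n·v, n⁻¹m⁻¹), (u·n·m, w))` of [FrdI] Example 3.9 on the positive-cone tempered
# Frobenioid `ConeTwist.C`: an involutive self-equivalence of its category (toy data, part 2 of 3)

S. Mochizuki, *The geometry of Frobenioids I*, Kyushu J. Math. **62** (2008), Example 3.9 (kurims p. 72): "the
assignment `(u, v, w, n, m) ↦ (v, u, w, n⁻¹·m⁻¹, m)` … determines an automorphism of the monoid `M`, hence a
self-equivalence of `C`" [cite: MochizukiFrdI2008, Ex. 3.9 p.72]; Thm. 5.2 (i) p. 100 (model Frobenioids)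
[cite: MochizukiFrdI2008, Thm. 5.2 (i) p.100]; [EtTh] Def. 3.6 (ii) p. 77 [cite: MochizukiEtTh2009, Def 3.6 p.77].

abc-iut cell, block F, seat abc-iut-f-032 (gen 6).  Part 2 of the positive-cone record (part 1:
`TemperedFrobenioidToyCone.lean`).  The category of `ConeTwist.C` is the model Frobenioid; its arrows `(m, g, z, b)` have
the unit component DETERMINED by the relation (`hom_ext₃`, `mkHom` — abc-iut-f-023's `OTriTwist` algebra verbatim, now over
the cones).  Mochizuki's swap PRESERVES both cones (`n·v ≥ 0` for `swapBase`, `u·n·m ≥ 0` for `swapDiv`), so it is still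
a functor (`swapMap_comp`), an involution (`swapMap_swapMap`) and a self-equivalence `swapEquiv : C.category ≌ C.category`.
Also recorded (data for part 3): the translation `t = (1,1) ∈ W`, the Frobenius-trivial object `X₀ = (•, 0)` and its
pre-step `π₀ = (1, 1_W, (1,0))`.  DATA + bookkeeping lemmas; no claim about any paper.  HONEST FRAMING: toy data over OUR
typed interfaces; nothing here bears on the disputed [IUTchIII] Cor. 3.12; no side taken; typed ≠ proved.
-/

noncomputable section

namespace Literature.AnabelianGeometry.EtaleTheta

open CategoryTheory Opposite Literature.AlgebraicGeometry.Frobenioids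

namespace ConeTwist

open RatSemidirect Ex39

/-! ### §2  The category of `C` and the swap autoequivalence (OTriTwist's algebra on the cones) -/

variable {X Y Z : C.category}

/-- Coordinates of an arrow of `C`: the base component in `W`. [cite: MochizukiFrdI2008, Thm. 5.2 (i) p.100] -/
def gW (φ : X ⟶ Y) : W := ModelFrobenioid.baseMap φ

/-- Coordinates of an arrow of `C`: the base component as an element of `G = U ⋊ N`. [cite: MochizukiFrdI2008, Thm. 5.2 (i) p.100] -/
def gOf (φ : X ⟶ Y) : G := (gW φ : G)

/-- Coordinates of an arrow of `C`: the zero divisor in the cone `ℚ_{≥0} × ℤ_{≥0}`. [cite: MochizukiFrdI2008, Thm. 5.2 (i) p.100] -/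
def divVWp (φ : X ⟶ Y) : VWp := (ModelFrobenioid.div φ).1

/-- Coordinates of an arrow of `C`: the zero divisor in `V × W` (multiplicative). [cite: MochizukiFrdI2008, Thm. 5.2 (i) p.100] -/
def divVW (φ : X ⟶ Y) : OTriTwist.VW := (divVWp φ).1

/-- Coordinates of an arrow of `C`: the zero divisor `(v, w) ∈ ℚ_{≥0} × ℤ_{≥0}`. [cite: MochizukiFrdI2008, Thm. 5.2 (i) p.100] -/
def zOf (φ : X ⟶ Y) : ℚ × ℕ := Multiplicative.toAdd (divVW φ)

/-- The translation part of the base is `≥ 0`. [cite: MochizukiFrdI2008, Ex. 3.9 p.72] -/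
theorem gOf_u_nonneg (φ : X ⟶ Y) : 0 ≤ (gOf φ).u := (gW φ).2

/-- The `V`-coordinate of the divisor is `≥ 0`. [cite: MochizukiFrdI2008, Ex. 3.9 p.72] -/
theorem zOf_fst_nonneg (φ : X ⟶ Y) : 0 ≤ (zOf φ).1 := (divVWp φ).2

/-- `Base(id) = 1`. [cite: MochizukiFrdI2008, Thm. 5.2 (i) p.100] -/
theorem gOf_id (X : C.category) : gOf (𝟙 X) = 1 := rfl

/-- `Div(id) = 0`. [cite: MochizukiFrdI2008, Thm. 5.2 (i) p.100] -/
theorem zOf_id (X : C.category) : zOf (𝟙 X) = 0 := rfl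

/-- `Base` of a composite, in `W`. [cite: MochizukiFrdI2008, Thm. 5.2 (i) p.100] -/
theorem gW_comp (φ : X ⟶ Y) (ψ : Y ⟶ Z) : gW (φ ≫ ψ) = gW ψ * gW φ := rfl

/-- `Base` of a composite, in `G`. [cite: MochizukiFrdI2008, Thm. 5.2 (i) p.100] -/
theorem gOf_comp (φ : X ⟶ Y) (ψ : Y ⟶ Z) : gOf (φ ≫ ψ) = gOf ψ * gOf φ := rfl

/-- `Div` of a composite, in coordinates: `(n_φ⁻¹·v_ψ + m_ψ·v_φ, w_ψ + m_ψ·w_φ)`. [cite: MochizukiFrdI2008, Thm. 5.2 (i) p.100] -/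
theorem zOf_comp (φ : X ⟶ Y) (ψ : Y ⟶ Z) :
    zOf (φ ≫ ψ) = (((gOf φ).n : ℚ)⁻¹ * (zOf ψ).1 + ((ModelFrobenioid.degFr ψ : ℕ) : ℚ) * (zOf φ).1,
      (zOf ψ).2 + (ModelFrobenioid.degFr ψ : ℕ) * (zOf φ).2) := by
  change Multiplicative.toAdd (act' (gOf φ) (divVW ψ) * divVW φ ^ (ModelFrobenioid.degFr ψ : ℕ)) = _
  rw [toAdd_mul, toAdd_pow, toAdd_act']
  ext <;> simp [zOf, nsmul_eq_mul]

/-- The relation (d) of Thm. 5.2 (i) DETERMINES the unit component (`Div_B = id`). [cite: MochizukiFrdI2008, Thm. 5.2 (i) p.100] -/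
theorem unit_snd_eq (φ : X ⟶ Y) :
    ((ModelFrobenioid.unit φ).1).2 =
      (pullGp C.divisorMonoid (ModelFrobenioid.baseMap φ) Y.cls)⁻¹ *
        (X.cls ^ (ModelFrobenioid.degFr φ : ℕ) * Algebra.GrothendieckGroup.of (ModelFrobenioid.div φ)) :=
  eq_inv_mul_of_mul_eq (ModelFrobenioid.rel φ).symm

/-- **Arrows of `C` are determined by `(deg_Fr, Base, Div)`**. [cite: MochizukiFrdI2008, Thm. 5.2 (i) p.100] -/
theorem hom_ext₃ {φ ψ : X ⟶ Y} (h₁ : ModelFrobenioid.degFr φ = ModelFrobenioid.degFr ψ) (h₂ : gW φ = gW ψ)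
    (h₃ : zOf φ = zOf ψ) : φ = ψ := by
  have h₂' : ModelFrobenioid.baseMap φ = ModelFrobenioid.baseMap ψ := h₂
  have h₃' : ModelFrobenioid.div φ = ModelFrobenioid.div ψ :=
    Subtype.ext (Subtype.ext (Multiplicative.toAdd.injective h₃))
  apply ModelFrobenioid.hom_ext h₁ h₂' h₃'
  have h4 : ((ModelFrobenioid.unit φ).1).2 = ((ModelFrobenioid.unit ψ).1).2 := by
    rw [unit_snd_eq, unit_snd_eq, h₁, h₂', h₃']
  refine Subtype.ext (Prod.ext ?_ h4)
  exact ((ModelFrobenioid.unit φ).2).trans ((congrArg (C.ΦgpToRlog _) h4).trans (ModelFrobenioid.unit ψ).2.symm)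

/-- The unit component solved from the relation. [cite: MochizukiFrdI2008, Thm. 5.2 (i) p.100] -/
def solveUnit (X Y : C.category) (m : ℕ+) (g : X.base ⟶ Y.base) (z : C.divisorMonoid.obj (op X.base)) :
    Algebra.GrothendieckGroup (C.divisorMonoid.obj (op X.base)) :=
  (pullGp C.divisorMonoid g Y.cls)⁻¹ * (X.cls ^ (m : ℕ) * Algebra.GrothendieckGroup.of z)

/-- The arrow of `C` with prescribed `(deg_Fr, Base, Div)`. [cite: MochizukiFrdI2008, Thm. 5.2 (i) p.100] -/
def mkHom (X Y : C.category) (m : ℕ+) (g : X.base ⟶ Y.base) (z : C.divisorMonoid.obj (op X.base)) : X ⟶ Y where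
  degFr := m
  base := g
  div := z
  unit := ⟨(C.ΦgpToRlog _ (solveUnit X Y m g z), solveUnit X Y m g z), rfl⟩
  rel := by
    change X.cls ^ (m : ℕ) * Algebra.GrothendieckGroup.of z = pullGp C.divisorMonoid g Y.cls * solveUnit X Y m g z
    rw [solveUnit, mul_inv_cancel_left]

/-- The swapped base `(n·v, n⁻¹·m⁻¹)`; it lies in the cone `W` because `v ≥ 0`. [cite: MochizukiFrdI2008, Ex. 3.9 p.72] -/
def swapBase (φ : X ⟶ Y) : W :=
  ⟨⟨((gOf φ).n : ℚ) * (zOf φ).1, (gOf φ).n⁻¹ * (natPos (ModelFrobenioid.degFr φ))⁻¹⟩,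
    mul_nonneg (le_of_lt (gOf φ).n.2) (zOf_fst_nonneg φ)⟩

/-- Components of the swapped base. [cite: MochizukiFrdI2008, Ex. 3.9 p.72] -/
@[simp] theorem swapBase_u (φ : X ⟶ Y) : ((swapBase φ : W) : G).u = ((gOf φ).n : ℚ) * (zOf φ).1 := rfl

/-- Components of the swapped base. [cite: MochizukiFrdI2008, Ex. 3.9 p.72] -/
@[simp] theorem swapBase_n (φ : X ⟶ Y) :
    ((swapBase φ : W) : G).n = (gOf φ).n⁻¹ * (natPos (ModelFrobenioid.degFr φ))⁻¹ := rfl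

/-- The swapped divisor `(u·n·m, w)`; it lies in the cone `ℚ_{≥0} × ℤ_{≥0}` because `u ≥ 0`. [cite: MochizukiFrdI2008, Ex. 3.9 p.72] -/
def swapDiv (φ : X ⟶ Y) : C.divisorMonoid.obj (op X.base) :=
  ⟨⟨Multiplicative.ofAdd ((gOf φ).u * ((gOf φ).n : ℚ) * ((ModelFrobenioid.degFr φ : ℕ) : ℚ), (zOf φ).2),
    mul_nonneg (mul_nonneg (gOf_u_nonneg φ) (le_of_lt (gOf φ).n.2)) (Nat.cast_nonneg _)⟩, trivial⟩

/-- **The swap** `(m, (u,n), (v,w)) ↦ (m, (n·v, n⁻¹m⁻¹), (u·n·m, w))` on one arrow of `C`. [cite: MochizukiFrdI2008, Ex. 3.9 p.72] -/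
def swapMap (φ : X ⟶ Y) : X ⟶ Y := mkHom X Y (ModelFrobenioid.degFr φ) (swapBase φ) (swapDiv φ)

/-- Frobenius degrees are untouched by the swap. [cite: MochizukiFrdI2008, Ex. 3.9 p.72] -/
@[simp] theorem degFr_swapMap (φ : X ⟶ Y) : ModelFrobenioid.degFr (swapMap φ) = ModelFrobenioid.degFr φ := rfl

/-- The base of a swapped arrow, in `W`. [cite: MochizukiFrdI2008, Ex. 3.9 p.72] -/
theorem gW_swapMap (φ : X ⟶ Y) : gW (swapMap φ) = swapBase φ := rfl

/-- The base of a swapped arrow, in `G`. [cite: MochizukiFrdI2008, Ex. 3.9 p.72] -/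
@[simp] theorem gOf_swapMap (φ : X ⟶ Y) : gOf (swapMap φ) = (swapBase φ : G) := rfl

/-- The divisor of a swapped arrow. [cite: MochizukiFrdI2008, Ex. 3.9 p.72] -/
@[simp] theorem zOf_swapMap (φ : X ⟶ Y) :
    zOf (swapMap φ) = ((gOf φ).u * ((gOf φ).n : ℚ) * ((ModelFrobenioid.degFr φ : ℕ) : ℚ), (zOf φ).2) := rfl

/-- The swap fixes identities. [cite: MochizukiFrdI2008, Ex. 3.9 p.72] -/
theorem swapMap_id (X : C.category) : swapMap (𝟙 X) = 𝟙 X := by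
  refine hom_ext₃ rfl (Subtype.ext (G.ext ?_ ?_)) ?_
  · change ((swapBase (𝟙 X) : W) : G).u = (gOf (𝟙 X)).u
    rw [swapBase_u, gOf_id, zOf_id]
    simp
  · change ((swapBase (𝟙 X) : W) : G).n = (gOf (𝟙 X)).n
    rw [swapBase_n, gOf_id, ModelFrobenioid.degFr_id, G.one_n, map_one, inv_one, mul_one]
  · rw [zOf_swapMap, zOf_id, gOf_id, ModelFrobenioid.degFr_id]
    simp

/-- **The swap is multiplicative** on all hom-sets. [cite: MochizukiFrdI2008, Ex. 3.9 p.72] -/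
theorem swapMap_comp (φ : X ⟶ Y) (ψ : Y ⟶ Z) : swapMap (φ ≫ ψ) = swapMap φ ≫ swapMap ψ := by
  have hφ : ((gOf φ).n : ℚ) ≠ 0 := ne_of_gt (gOf φ).n.2
  have hψ : ((gOf ψ).n : ℚ) ≠ 0 := ne_of_gt (gOf ψ).n.2
  have hm : (((ModelFrobenioid.degFr φ : ℕ+) : ℕ) : ℚ) ≠ 0 := by exact_mod_cast (ModelFrobenioid.degFr φ).ne_zero
  refine hom_ext₃ rfl (Subtype.ext (G.ext ?_ ?_)) ?_
  · change ((swapBase (φ ≫ ψ) : W) : G).u = (gOf (swapMap φ ≫ swapMap ψ)).u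
    rw [gOf_comp, G.mul_u]
    simp only [gOf_swapMap, swapBase_u, swapBase_n, gOf_comp, zOf_comp, G.mul_n, Positive.val_mul,
      Positive.coe_inv, natPos_val]
    field_simp
  · change ((swapBase (φ ≫ ψ) : W) : G).n = (gOf (swapMap φ ≫ swapMap ψ)).n
    rw [gOf_comp, G.mul_n]
    simp only [gOf_swapMap, swapBase_n, gOf_comp, ModelFrobenioid.degFr_comp, G.mul_n, map_mul, mul_inv]
    rw [mul_mul_mul_comm]
  · rw [zOf_comp]
    simp only [zOf_swapMap, gOf_swapMap, degFr_swapMap, swapBase_n, gOf_comp, zOf_comp, ModelFrobenioid.degFr_comp,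
      G.mul_u, G.mul_n, Positive.val_mul, Positive.coe_inv, natPos_val, PNat.mul_coe, Nat.cast_mul, Prod.mk.injEq]
    refine ⟨?_, trivial⟩
    field_simp

/-- **The swap as an endofunctor** of the category of `C` (identity on objects). [cite: MochizukiFrdI2008, Ex. 3.9 p.72] -/
def swap : C.category ⥤ C.category where
  obj X := X
  map φ := swapMap φ
  map_id X := swapMap_id X
  map_comp φ ψ := swapMap_comp φ ψ

/-- **The swap is an involution.** [cite: MochizukiFrdI2008, Ex. 3.9 p.72] -/
theorem swapMap_swapMap (φ : X ⟶ Y) : swapMap (swapMap φ) = φ := by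
  have hφ : ((gOf φ).n : ℚ) ≠ 0 := ne_of_gt (gOf φ).n.2
  have hm : (((ModelFrobenioid.degFr φ : ℕ+) : ℕ) : ℚ) ≠ 0 := by exact_mod_cast (ModelFrobenioid.degFr φ).ne_zero
  refine hom_ext₃ rfl (Subtype.ext (G.ext ?_ ?_)) ?_
  · change ((swapBase (swapMap φ) : W) : G).u = (gOf φ).u
    simp only [swapBase_u, swapBase_n, gOf_swapMap, zOf_swapMap, Positive.val_mul, Positive.coe_inv, natPos_val]
    field_simp
  · change ((swapBase (swapMap φ) : W) : G).n = (gOf φ).n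
    simp only [swapBase_n, gOf_swapMap, degFr_swapMap, mul_inv, inv_inv]
    rw [mul_inv_cancel_right]
  · rw [zOf_swapMap, gOf_swapMap, swapBase_u, swapBase_n, degFr_swapMap, zOf_swapMap]
    ext
    · simp only [Positive.val_mul, Positive.coe_inv, natPos_val]
      field_simp
    · rfl

/-- `swap ⋙ swap ≅ 𝟭`. [cite: MochizukiFrdI2008, Ex. 3.9 p.72] -/
def swapSwapIso : swap ⋙ swap ≅ 𝟭 C.category :=
  NatIso.ofComponents (fun X => Iso.refl X) fun {X Y} φ => by
    refine (Category.comp_id _).trans (Eq.trans ?_ (Category.id_comp _).symm)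
    exact swapMap_swapMap φ

/-- **The swap is a self-equivalence of the category of `C`.** [cite: MochizukiFrdI2008, Ex. 3.9 p.72] -/
def swapEquiv : C.category ≌ C.category :=
  CategoryTheory.Equivalence.mk swap swap swapSwapIso.symm swapSwapIso


/-! ### Data for part 3: the translation `t`, the Frobenius-trivial object and its pre-step `π₀` -/

/-- The translation `t = (1, 1) ∈ W`. [cite: MochizukiFrdI2008, Ex. 3.9 p.72] -/
def t : W := ⟨⟨1, 1⟩, (zero_le_one : (0 : ℚ) ≤ 1)⟩

/-- The Frobenius-trivial object `(•, 0)`. [cite: MochizukiFrdI2008, Thm. 5.2 (i) p.100] -/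
abbrev X₀ : C.category := ⟨SingleObj.star W, 1⟩

/-- `π₀ = (1, 1_W, (1, 0))`: a base-identity linear endomorphism of `(•, 0)` with divisor `(1, 0)` — a PRE-STEP
(indeed an element of `O^▷((•, 0))`). [cite: MochizukiFrdI2008, Def. 1.2 (iii) p.22] -/
def π₀ : (X₀ : C.category) ⟶ X₀ :=
  mkHom X₀ X₀ 1 (𝟙 _) ⟨⟨Multiplicative.ofAdd ((1 : ℚ), (0 : ℕ)), (zero_le_one : (0 : ℚ) ≤ 1)⟩, trivial⟩

end ConeTwist

end Literature.AnabelianGeometry.EtaleTheta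

end
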